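import Summits.QuantumAdvantage.QuantumAdvantage.Theorems.CubicForrelationNearExactIsExactFiveFlatLemma

/-!
# Crux `CubicForrelation.NearExactIsExact` (stmt-QuantumAdvantage-14043) — the FOUR-FLAT DIVISIBILITY LEMMA and a restriction chart that
  transports every "flat-count" hypothesis

Certificate seat `b2b-cforr-cert` (gen 23).  HONEST FRAMING: a combinatorial BRICK (standard axioms, no `decide`, uniform in the number of bits) for
the boundary rung `Φ = 29/32` of the `n = 12` ladder (level-5 branch, configurations R2(a)/R2(b) of HOME/b2b-cforr-cert-g23/PROOF-N12-928-L5.md).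
NOT summit progress.

* `ffl_flatPt_zero`, `ffl_flatPt_single`, `ffl_ip_bxor`: bookkeeping for parametrised flats `ε ↦ b ⊕ ⊕_{εᵢ=1} aᵢ` and the parity `⟨x,z⟩`.
* `ffl_restrict_flats`: restriction of an ARBITRARY Boolean function `c` on `k+1` bits to an affine hyperplane `{⟨x,z⟩ = b}` through the
  affine chart of `ffl_restrict`, keeping the count, and transporting EVERY hypothesis of the form "for all parametrised `r`-flats INSIDE the
  hyperplane (base point on it, directions in `z^⊥`), `q` divides the number of ones" to all parametrised `r`-flats of `𝔽₂^k`
  (an affine image of a parametrised flat is a parametrised flat, `ffl_affine_is_flat`; its base point lies on the hyperplane and its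
  directions in `z^⊥`).
* `ffl_four_weight` (**four-flat divisibility lemma**): if `m ≥ 4` and EVERY parametrised 4-flat of `𝔽₂^m` carries a number of ones of `c`
  divisible by `4`, then `2^{m−2} ∣ #{c = 1}`.  (Induction on `m`; hyperplane sections `w₀ + w₁ = w` are `≡ 0 (mod N = 2^{m−3})` by induction;
  if `w/N` were odd then `|w₀ − w₁| ≥ N` for every hyperplane pair and Parseval `Σ_{z≠0} F(z)² = w(2^m − w) ≤ 16N²` would contradict
  `(2^m − 1)N² = (8N−1)N²` for `N ≥ 4`.)  No degree hypothesis is needed.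

References: F. J. MacWilliams, N. J. A. Sloane (1977) Ch. 13–15 (Reed–Muller codes, flats); R. O'Donnell (2014) §3.3 (Parseval).  The lemma is
this seat's own.  Everything below is proved from Mathlib and the tree; axioms are the standard three.
-/

set_option linter.dupNamespace false -- D-0017: single-problem summit ⇒ `QuantumAdvantage.QuantumAdvantage` by design

noncomputable section

namespace Summit.QuantumAdvantage.QuantumAdvantage.Theorems.CubicForrelation.NearExactIsExact

open Finset
open Literature.Computability.QuantumComplexity
open Literature.Computability.QuantumComplexity.BuzetChailloux (bxor zeroVec)
open Literature.Computability.QuantumComplexity.DerivativeWalsh (W twist_bxor_left)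
open Literature.Computability.QuantumComplexity.Simon (twist_eq_one_or)
open Summit.QuantumAdvantage.QuantumAdvantage.Theorems.SignedCubicForrelationNotPrBPP (knf_isDegLeFun_ip knf_isDegLeFun_comp)

/-! ### Bookkeeping for parametrised flats -/

/-- The parametrised flat at `ε = 0` is its base point. [folklore] -/
theorem ffl_flatPt_zero {k n : ℕ} (b : Fin n → Bool) (a : Fin k → Fin n → Bool) :
    (fun j => b j ^^ decide (Odd #(univ.filter fun i => (fun _ : Fin k => false) i && a i j))) = b := by
  funext j
  rw [show (univ.filter fun i => (fun _ : Fin k => false) i && a i j) = ∅ from filter_eq_empty_iff.2 fun i _ => by simp]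
  simp

/-- The parametrised flat at the unit vector `eᵢ` is `b ⊕ aᵢ`. [folklore] -/
theorem ffl_flatPt_single {k n : ℕ} (b : Fin n → Bool) (a : Fin k → Fin n → Bool) (i : Fin k) :
    (fun j => b j ^^ decide (Odd #(univ.filter fun i' => (fun l : Fin k => decide (l = i)) i' && a i' j))) = bxor b (a i) := by
  classical
  funext j
  have e : (univ.filter fun i' => (fun l : Fin k => decide (l = i)) i' && a i' j) = if a i j = true then {i} else ∅ := by
    ext i'
    by_cases h : i' = i
    · subst h; cases h' : a i' j <;> simp [h']
    · cases h' : a i j <;> simp [h]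
  rw [e]
  show (b j ^^ _) = (b j ^^ a i j)
  cases h' : a i j <;> simp

/-- The parity `⟨x,z⟩` is additive in `x`: `⟨x ⊕ y, z⟩ = ⟨x,z⟩ ⊕ ⟨y,z⟩`. [folklore] -/
theorem ffl_ip_bxor {n : ℕ} (x y z : Fin n → Bool) :
    decide (Odd #(univ.filter fun i => (bxor x y i && z i) = true)) =
      (decide (Odd #(univ.filter fun i => (x i && z i) = true)) ^^ decide (Odd #(univ.filter fun i => (y i && z i) = true))) := by
  have hinj : ∀ u v : Bool, signOf u = signOf v → u = v := by
    intro u v; cases u <;> cases v <;> norm_num [signOf]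
  apply hinj
  rw [signOf_xor, ← vg_twist_eq_signOf, ← vg_twist_eq_signOf, ← vg_twist_eq_signOf]
  exact twist_bxor_left x y z

/-! ### Restriction to a hyperplane, transporting flat-count hypotheses -/

/-- **Restriction chart transporting flat-count hypotheses.**  For ANY Boolean function `c` on `k + 1` bits, a covector `z` with a pivot
`z_{i₀} = 1` and `b ∈ 𝔽₂`, the restriction of `c` to the hyperplane `{⟨x,z⟩ = b}` (read through the affine chart of `ffl_restrict`) is a
function `c'` on `k` bits with exactly `#{x : c x = 1, ⟨x,z⟩ = b}` ones, of degree `≤ d` whenever `c` is, and such that for every `r, q`: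
if `q` divides the number of ones of `c` on every parametrised `r`-flat with base point on the hyperplane and directions in `z^⊥`, then `q`
divides the number of ones of `c'` on every parametrised `r`-flat of `𝔽₂^k`. [folklore; affine invariance] -/
theorem ffl_restrict_flats {k : ℕ} (c : (Fin (k + 1) → Bool) → Bool)
    (z : Fin (k + 1) → Bool) (i₀ : Fin (k + 1)) (hz : z i₀ = true) (b : Bool) :
    ∃ c' : (Fin k → Bool) → Bool,
      (∀ d, IsDegLeFun d c → IsDegLeFun d c') ∧
      #(univ.filter fun y => c' y = true) =
        #(univ.filter fun x => c x = true ∧ decide (Odd #(univ.filter fun i => (x i && z i) = true)) = b) ∧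
      ∀ (r q : ℕ), (∀ (b'' : Fin (k + 1) → Bool) (a'' : Fin r → Fin (k + 1) → Bool),
          decide (Odd #(univ.filter fun i => (b'' i && z i) = true)) = b →
          (∀ i, decide (Odd #(univ.filter fun l => (a'' i l && z l) = true)) = false) →
          q ∣ #(univ.filter fun ε : Fin r → Bool =>
            c (fun j => b'' j ^^ decide (Odd #(univ.filter fun i => ε i && a'' i j))) = true)) →
        ∀ (b' : Fin k → Bool) (a' : Fin r → Fin k → Bool),
          q ∣ #(univ.filter fun ε : Fin r → Bool =>
            c' (fun j => b' j ^^ decide (Odd #(univ.filter fun i => ε i && a' i j))) = true) := by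
  classical
  -- the chart (as in `ffl_restrict`)
  set v : (Fin k → Bool) → Bool := fun y =>
    b ^^ decide (Odd #(univ.filter fun j : Fin k => (y j && z (i₀.succAbove j)) = true)) with hvdef
  set s : (Fin k → Bool) → (Fin (k + 1) → Bool) := fun y => Fin.insertNth (α := fun _ => Bool) i₀ (v y) y with hsdef
  have hs0 : ∀ y, s y i₀ = v y := fun y => by simp [hsdef]
  have hsj : ∀ y (j : Fin k), s y (i₀.succAbove j) = y j := fun y j => by simp [hsdef]
  have hsH : ∀ y, decide (Odd #(univ.filter fun i => (s y i && z i) = true)) = b := by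
    intro y
    rw [ktg_card_and_split _ _ i₀, hs0, hz, Bool.and_true]
    simp_rw [hsj]
    exact ktg_xor_parity b _
  have hsr : ∀ x : Fin (k + 1) → Bool, decide (Odd #(univ.filter fun i => (x i && z i) = true)) = b →
      s (Fin.removeNth (α := fun _ => Bool) i₀ x) = x := by
    intro x hx
    rw [ktg_card_and_split _ _ i₀, hz, Bool.and_true] at hx
    have hv : v (Fin.removeNth (α := fun _ => Bool) i₀ x) = x i₀ := by
      simp only [hvdef, Fin.removeNth]
      exact ktg_xor_parity' (x i₀) b _ hx
    simp only [hsdef]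
    rw [hv]
    exact Fin.insertNth_self_removeNth (α := fun _ => Bool) i₀ x
  have hsdeg : ∀ j, IsDegLeFun 1 (fun y => s y j) := by
    intro j
    rcases Fin.eq_self_or_eq_succAbove i₀ j with hj | ⟨j', hj⟩
    · have e : (fun y => s y j) = v := funext fun y => by rw [hj, hs0]
      rw [e]
      exact bb_isDegLeFun_bxor (isDegLeFun_const 1 b) (knf_isDegLeFun_ip fun j => z (i₀.succAbove j))
    · have e : (fun y => s y j) = fun y => y j' := funext fun y => by rw [hj, hsj]
      rw [e]
      exact isDegLeFun_apply j' le_rfl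
  refine ⟨fun y => c (s y), fun d hc => knf_isDegLeFun_comp hc s hsdeg, ?_, ?_⟩
  · -- counting through the chart
    refine card_nbij' s (fun x => Fin.removeNth (α := fun _ => Bool) i₀ x) (fun y hy => ?_) (fun x hx => ?_)
      (fun y _ => Fin.removeNth_insertNth (α := fun _ => Bool) i₀ (v y) y) (fun x hx => ?_)
    · rw [mem_coe, mem_filter] at hy
      rw [mem_coe, mem_filter]
      exact ⟨mem_univ _, hy.2, hsH y⟩
    · rw [mem_coe, mem_filter] at hx
      rw [mem_coe, mem_filter]
      refine ⟨mem_univ _, ?_⟩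
      show c (s (Fin.removeNth (α := fun _ => Bool) i₀ x)) = true
      rw [hsr x hx.2.2]; exact hx.2.1
    · rw [mem_coe, mem_filter] at hx
      exact hsr x hx.2.2
  · -- transport of flat-count hypotheses
    intro r q hyp b' a'
    set φ : (Fin r → Bool) → (Fin (k + 1) → Bool) :=
      fun ε => s (fun j => b' j ^^ decide (Odd #(univ.filter fun i => ε i && a' i j))) with hφ
    have hφdeg : ∀ j, IsDegLeFun 1 (fun ε => φ ε j) := fun j =>
      knf_isDegLeFun_comp (hsdeg j) _ fun l => bb_isDegLeFun_bxor (isDegLeFun_const 1 (b' l)) (knf_isDegLeFun_ip fun i => a' i l)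
    obtain ⟨b'', a'', hba⟩ := ffl_affine_is_flat φ hφdeg
    -- the base point lies on the hyperplane, the directions in `z^⊥`
    have hb'' : decide (Odd #(univ.filter fun i => (b'' i && z i) = true)) = b := by
      have h0 := hba (fun _ => false)
      rw [ffl_flatPt_zero] at h0
      rw [← h0]
      exact hsH _
    have ha'' : ∀ i, decide (Odd #(univ.filter fun l => (a'' i l && z l) = true)) = false := by
      intro i
      have h1 := hba (fun l => decide (l = i))
      rw [ffl_flatPt_single] at h1
      have hP : decide (Odd #(univ.filter fun l => (bxor b'' (a'' i) l && z l) = true)) = b := by rw [← h1]; exact hsH _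
      rw [ffl_ip_bxor, hb''] at hP
      revert hP; cases b <;> cases decide (Odd #(univ.filter fun l => (a'' i l && z l) = true)) <;> simp
    have e : (univ.filter fun ε : Fin r → Bool => c (φ ε) = true) =
        univ.filter fun ε => c (fun j => b'' j ^^ decide (Odd #(univ.filter fun i => ε i && a'' i j))) = true :=
      filter_congr fun ε _ => by rw [hba ε]
    change q ∣ #(univ.filter fun ε : Fin r → Bool => c (φ ε) = true)
    rw [e]
    exact hyp b'' a'' hb'' ha''

/-! ### The four-flat divisibility lemma -/

/-- The identity parametrisation of `𝔽₂⁴` by itself counts the support once. [folklore] -/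
theorem ffl_identity_count_four (c : (Fin 4 → Bool) → Bool) :
    #(univ.filter fun ε : Fin 4 → Bool =>
      c (fun j => (fun _ : Fin 4 => false) j ^^ decide (Odd #(univ.filter fun i => ε i && decide (i = j)))) = true) =
      #(univ.filter fun x : Fin 4 → Bool => c x = true) := by
  classical
  have hpt : ∀ ε : Fin 4 → Bool,
      (fun j => (fun _ : Fin 4 => false) j ^^ decide (Odd #(univ.filter fun i => ε i && decide (i = j)))) = ε := by
    intro ε
    funext j
    have e : (univ.filter fun i : Fin 4 => ε i && decide (i = j)) = if ε j = true then {j} else ∅ := by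
      ext i
      by_cases hij : i = j
      · subst hij
        cases h : ε i <;> simp [h]
      · cases h : ε j <;> simp [hij]
    rw [e]
    cases h : ε j <;> simp
  exact congrArg card (filter_congr fun ε _ => by rw [hpt ε])

/-- **The four-flat divisibility lemma.**  For `m ≥ 4` and any `c : 𝔽₂^m → 𝔽₂`: if every parametrised 4-flat `ε ↦ b ⊕ ⊕_{εᵢ=1} aᵢ`
carries a number of ones of `c` divisible by `4`, then `2^{m−2} ∣ #{c = 1}`.  See the module docstring for the proof. [this work] -/
theorem ffl_four_weight : ∀ (m : ℕ), 4 ≤ m → ∀ (c : (Fin m → Bool) → Bool),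
    (∀ (b : Fin m → Bool) (a : Fin 4 → Fin m → Bool),
      4 ∣ #(univ.filter fun ε : Fin 4 → Bool =>
        c (fun j => b j ^^ decide (Odd #(univ.filter fun i => ε i && a i j))) = true)) →
    2 ^ (m - 2) ∣ #(univ.filter fun x => c x = true) := by
  intro m
  induction m with
  | zero => intro h; omega
  | succ k ih =>
    intro hk c h4
    classical
    rcases Nat.lt_or_ge k 4 with hk4 | hk4
    · -- `m = 4`
      obtain rfl : k = 3 := by omega
      have h := h4 (fun _ => false) (fun i j => decide (i = j))
      rw [ffl_identity_count_four] at h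
      exact h
    -- `m = k + 1 ≥ 5`; `N = 2^{k-2} ≥ 4`
    have ih' := ih hk4
    obtain ⟨κ, hκ⟩ : ∃ κ, k = κ + 2 := ⟨k - 2, by omega⟩
    set N : ℕ := 2 ^ κ with hNdef
    have hN4 : 4 ≤ N := by
      have : 2 ^ 2 ≤ 2 ^ κ := Nat.pow_le_pow_right (by norm_num) (by omega)
      rw [hNdef]; simpa using this
    have h2k1 : 2 ^ (k + 1) = 8 * N := by rw [hκ, hNdef, pow_add, pow_succ]; ring
    have h2k2 : 2 ^ (k - 2) = N := by rw [hκ, hNdef]; simp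
    have h2m2 : 2 ^ (k + 1 - 2) = 2 * N := by rw [show k + 1 - 2 = κ + 1 by omega, hNdef, pow_succ]; ring
    set S := univ.filter (fun x : Fin (k + 1) → Bool => c x = true) with hSdef
    set w := #S with hwdef
    rw [h2m2]
    -- hyperplane sections are `≡ 0 (mod N)`
    set ℓ : (Fin (k + 1) → Bool) → (Fin (k + 1) → Bool) → Bool :=
      fun z x => decide (Odd #(univ.filter fun i => (x i && z i) = true)) with hℓdef
    have hsec : ∀ z : Fin (k + 1) → Bool, z ≠ zeroVec → ∀ β : Bool, N ∣ #(univ.filter fun x => c x = true ∧ ℓ z x = β) := by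
      intro z hz β
      obtain ⟨i₀, hi₀⟩ : ∃ i, z i = true := by
        by_contra h
        push Not at h
        exact hz (funext fun i => by simpa [zeroVec] using h i)
      obtain ⟨c', -, hcard', htr⟩ := ffl_restrict_flats c z i₀ hi₀ β
      have h5' := htr 4 4 (fun b'' a'' _ _ => h4 b'' a'')
      have h := ih' c' h5'
      rw [hcard', h2k2] at h
      exact h
    have hhalf : ∀ z, #(univ.filter fun x => c x = true ∧ ℓ z x = true) + #(univ.filter fun x => c x = true ∧ ℓ z x = false) = w :=
      fun z => ktg_half_add c z
    -- `N ∣ w`, and if `w/N` is odd every hyperplane pair is unbalanced by at least `N`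
    obtain ⟨z₁, hz₁⟩ : ∃ z : Fin (k + 1) → Bool, z ≠ zeroVec := by
      refine ⟨fun _ => true, fun h => ?_⟩
      have := congrFun h ⟨0, by omega⟩
      simp [zeroVec] at this
    have hNw : N ∣ w := by
      rw [← hhalf z₁]
      exact dvd_add (hsec z₁ hz₁ true) (hsec z₁ hz₁ false)
    obtain ⟨j, hj⟩ := hNw
    by_contra hcon
    have hjodd : ¬ 2 ∣ j := by
      rintro ⟨i, rfl⟩
      exact hcon ⟨i, by rw [hj]; ring⟩
    have hF : ∀ z : Fin (k + 1) → Bool, z ≠ zeroVec → (N : ℝ) ^ 2 ≤ (∑ x ∈ S, twist x z) ^ 2 := by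
      intro z hz
      have hFz := ktg_F_half c z
      change ∑ x ∈ S, twist x z = (w : ℝ) - 2 * (#(univ.filter fun x => c x = true ∧ ℓ z x = true) : ℝ) at hFz
      obtain ⟨j₁, hj₁⟩ := hsec z hz true
      obtain ⟨j₀, hj₀⟩ := hsec z hz false
      have hsum : N * j₁ + N * j₀ = N * j := by rw [← hj₁, ← hj₀, ← hj]; exact hhalf z
      have hsum' : j₁ + j₀ = j := by
        have hNpos : 0 < N := by omega
        have hsum'' : N * (j₁ + j₀) = N * j := by rw [mul_add]; exact hsum
        exact Nat.eq_of_mul_eq_mul_left hNpos hsum''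
      have hne : j₁ ≠ j₀ := by
        intro h; apply hjodd; exact ⟨j₁, by omega⟩
      rw [hFz, hj₁, hj]
      push_cast
      have hcase : (j₁ : ℝ) + 1 ≤ j₀ ∨ (j₀ : ℝ) + 1 ≤ j₁ := by
        rcases lt_or_gt_of_ne hne with h | h
        · left; exact_mod_cast h
        · right; exact_mod_cast h
      have hj₀R : (j₀ : ℝ) = j - j₁ := by
        have : ((j₀ : ℕ) : ℝ) = ((j - j₁ : ℕ) : ℝ) := by congr 1; omega
        rw [this]; push_cast [show j₁ ≤ j by omega]; ring
      have hNpos : (0 : ℝ) < N := by exact_mod_cast (by omega : 0 < N)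
      rcases hcase with h | h
      · -- `w - 2 N j₁ = N (j - 2 j₁) ≥ N`
        have hge : (N : ℝ) ≤ (N : ℝ) * j - 2 * ((N : ℝ) * j₁) := by
          rw [hj₀R] at h; nlinarith
        exact pow_le_pow_left₀ (by positivity) hge 2
      · have hle : (N : ℝ) ≤ -((N : ℝ) * j - 2 * ((N : ℝ) * j₁)) := by
          rw [hj₀R] at h; nlinarith
        have h' := pow_le_pow_left₀ (by positivity) hle 2
        rw [neg_sq] at h'
        exact h'
    -- Parseval
    have hP := ktg_parseval S
    have hF0 : ∑ x ∈ S, twist x zeroVec = (w : ℝ) := by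
      rw [sum_congr rfl fun x _ => BuzetChailloux.twist_zeroVec_right x, sum_const, nsmul_eq_mul, mul_one]
    have hsplit : ∑ z, (∑ x ∈ S, twist x z) ^ 2 =
        (∑ x ∈ S, twist x zeroVec) ^ 2 + ∑ z ∈ univ.erase zeroVec, (∑ x ∈ S, twist x z) ^ 2 :=
      (add_sum_erase univ (fun z => (∑ x ∈ S, twist x z) ^ 2) (mem_univ _)).symm
    have hcardE : #(univ.erase (zeroVec : Fin (k + 1) → Bool)) = 8 * N - 1 := by
      rw [card_erase_of_mem (mem_univ _), card_univ, Fintype.card_fun, Fintype.card_bool, Fintype.card_fin, h2k1]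
    have hlow : ((8 * N - 1 : ℕ) : ℝ) * (N : ℝ) ^ 2 ≤ ∑ z ∈ univ.erase zeroVec, (∑ x ∈ S, twist x z) ^ 2 := by
      have h := sum_le_sum (s := univ.erase (zeroVec : Fin (k + 1) → Bool)) (f := fun _ => (N : ℝ) ^ 2)
        (g := fun z => (∑ x ∈ S, twist x z) ^ 2) (fun z hz => hF z (ne_of_mem_erase hz))
      rw [sum_const, hcardE, nsmul_eq_mul] at h
      exact h
    rw [hsplit, hF0] at hP
    have hNR : ((2 : ℝ) ^ (k + 1)) = 8 * (N : ℝ) := by exact_mod_cast h2k1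
    rw [hNR] at hP
    have hu1 : 1 ≤ 8 * N := by omega
    have hcast : ((8 * N - 1 : ℕ) : ℝ) = 8 * (N : ℝ) - 1 := by push_cast [hu1]; ring
    rw [hcast] at hlow
    have hwR : (w : ℝ) = N * j := by exact_mod_cast hj
    have hN4R : (4 : ℝ) ≤ N := by exact_mod_cast hN4
    rw [hwR] at hP
    -- `Σ_{z≠0} F² = 8N·Nj − (Nj)² ≤ 16N²` but `≥ (8N−1)N²`
    nlinarith [sq_nonneg ((N : ℝ) * j - 4 * N)]

end Summit.QuantumAdvantage.QuantumAdvantage.Theorems.CubicForrelation.NearExactIsExact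

end
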